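import Summits.MatrixMultiplication.OmegaCensus.ThreeSetPairZ4Z4Kit
import HarnessLib

/-!
# Three-set cube shapes over `A ↠ ℤ₄ × ℤ₄`: reduction to the profile tables of the type-`W` character pair

ω-census `pub-omega`, family (b3), seat pub-omega-group gen 17.  Framing: lottery ticket; floor = certified bounds/negative
ranges.  VALUE: a kernel theorem about the group-theoretic method (TPP capacity of dihedral-like groups); NOT progress on ω.

**Theorem (`three_set_pairW_reduction`).**  The companion of `three_set_pair_reduction` (`ThreeSetPairZ4Z4.lean`) for the
character pair `{w + w', 3w + w'}` (type `W`) instead of `{w', w' + 2w}` (type `Y`): with `s = ⟨w + w', Φ·⟩` in place of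
`n = ⟨w', Φ·⟩` the profiles `(P_j, M_j)` count the points with `s = j` and `⟨w, Φ·⟩` even / odd; the three real characters give
the same three constraints; the identities read `c̄ a b + i c ā b + i c a b̄ = −i^l` (at `w + w'`: `ψβ = ψγ = i`) and
`c̄'a'b' − i c'ā'b' + i c'a'b̄' = −i^{l₂}` (at `3w + w'`: `ψβ = −i`, `ψγ = i`), `2l₂ = 2l`.  Exact pre-computation
(code/pair_profiles_types.py): this pair certifies `(3,7)`, `(5,7)`, `(3,9)`, `(5,9)` (tables `ThreeSetPairZ4Z4TablesW*.lean`),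
which the type-`Y` pair does not.
-/

namespace Summit.MatrixMultiplication.OmegaCensus

open Finset

section Main

variable {A : Type*} [AddCommGroup A] [Fintype A] [DecidableEq A]

/-- `i³ = −i` (exponent in `ZMod 4`). [folklore] -/
theorem ipow_zmod_three : (⟨0, 1⟩ : GaussianInt) ^ (3 : ZMod 4).val = -⟨0, 1⟩ := by decide

/-- `2n = 2(m + (m + n))` in `ZMod 4`. [folklore] -/
theorem zmod4_two_mul_eq (a b : ZMod 4) : 2 * b = 2 * (a + (a + b)) := by revert a b; decide

/-- **Reduction of a three-set shifted form over `A ↠ ℤ₄²` to profile data for the character pair `w + w', 3w + w'`.**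
[folklore] -/
theorem three_set_pairW_reduction (Φ : A →+ ZMod 4 × ZMod 4) (hΦ : Function.Surjective Φ)
    {W X Y : Finset A} {κ₁ κ₂ κ₃ x₀ : A}
    (i₁ : Set.InjOn (fun p : A × A × A => p.1 + p.2.1 + p.2.2) ↑((W.image fun w => κ₁ - w) ×ˢ X ×ˢ Y))
    (i₂ : Set.InjOn (fun p : A × A × A => p.1 + p.2.1 + p.2.2) ↑(W ×ˢ (X.image fun x => κ₂ - x) ×ˢ Y))
    (i₃ : Set.InjOn (fun p : A × A × A => p.1 + p.2.1 + p.2.2) ↑(W ×ˢ X ×ˢ (Y.image fun y => κ₃ - y)))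
    (d₁₂ : Disjoint (((W.image fun w => κ₁ - w) ×ˢ X ×ˢ Y).image fun p : A × A × A => p.1 + p.2.1 + p.2.2)
      ((W ×ˢ (X.image fun x => κ₂ - x) ×ˢ Y).image fun p : A × A × A => p.1 + p.2.1 + p.2.2))
    (d₁₃ : Disjoint (((W.image fun w => κ₁ - w) ×ˢ X ×ˢ Y).image fun p : A × A × A => p.1 + p.2.1 + p.2.2)
      ((W ×ˢ X ×ˢ (Y.image fun y => κ₃ - y)).image fun p : A × A × A => p.1 + p.2.1 + p.2.2))
    (d₂₃ : Disjoint ((W ×ˢ (X.image fun x => κ₂ - x) ×ˢ Y).image fun p : A × A × A => p.1 + p.2.1 + p.2.2)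
      ((W ×ˢ X ×ˢ (Y.image fun y => κ₃ - y)).image fun p : A × A × A => p.1 + p.2.1 + p.2.2))
    (hcover : (((W.image fun w => κ₁ - w) ×ˢ X ×ˢ Y).image fun p : A × A × A => p.1 + p.2.1 + p.2.2) ∪
      ((W ×ˢ (X.image fun x => κ₂ - x) ×ˢ Y).image fun p : A × A × A => p.1 + p.2.1 + p.2.2) ∪
      ((W ×ˢ X ×ˢ (Y.image fun y => κ₃ - y)).image fun p : A × A × A => p.1 + p.2.1 + p.2.2) = univ.erase x₀) :
    ∃ (P₀ M₀ P₁ M₁ P₂ M₂ P₃ M₃ S₀ T₀ S₁ T₁ S₂ T₂ S₃ T₃ : ℕ) (l l₂ : ZMod 4) (b b' : GaussianInt),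
      P₀ + M₀ + P₁ + M₁ + P₂ + M₂ + P₃ + M₃ = W.card ∧ S₀ + T₀ + S₁ + T₁ + S₂ + T₂ + S₃ + T₃ = X.card ∧
      (((P₀ + M₀ : ℕ) : ℤ) - (P₁ + M₁ : ℕ) + (P₂ + M₂ : ℕ) - (P₃ + M₃ : ℕ) = 1 ∨
        ((P₀ + M₀ : ℕ) : ℤ) - (P₁ + M₁ : ℕ) + (P₂ + M₂ : ℕ) - (P₃ + M₃ : ℕ) = -1) ∧
      (((P₀ : ℤ) - M₀) + ((P₁ : ℤ) - M₁) + ((P₂ : ℤ) - M₂) + ((P₃ : ℤ) - M₃) = 1 ∨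
        ((P₀ : ℤ) - M₀) + ((P₁ : ℤ) - M₁) + ((P₂ : ℤ) - M₂) + ((P₃ : ℤ) - M₃) = -1) ∧
      (((P₀ : ℤ) - M₀) - ((P₁ : ℤ) - M₁) + ((P₂ : ℤ) - M₂) - ((P₃ : ℤ) - M₃) = 1 ∨
        ((P₀ : ℤ) - M₀) - ((P₁ : ℤ) - M₁) + ((P₂ : ℤ) - M₂) - ((P₃ : ℤ) - M₃) = -1) ∧
      (((S₀ + T₀ : ℕ) : ℤ) - (S₁ + T₁ : ℕ) + (S₂ + T₂ : ℕ) - (S₃ + T₃ : ℕ) = 1 ∨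
        ((S₀ + T₀ : ℕ) : ℤ) - (S₁ + T₁ : ℕ) + (S₂ + T₂ : ℕ) - (S₃ + T₃ : ℕ) = -1) ∧
      (((S₀ : ℤ) - T₀) + ((S₁ : ℤ) - T₁) + ((S₂ : ℤ) - T₂) + ((S₃ : ℤ) - T₃) = 1 ∨
        ((S₀ : ℤ) - T₀) + ((S₁ : ℤ) - T₁) + ((S₂ : ℤ) - T₂) + ((S₃ : ℤ) - T₃) = -1) ∧
      (((S₀ : ℤ) - T₀) - ((S₁ : ℤ) - T₁) + ((S₂ : ℤ) - T₂) - ((S₃ : ℤ) - T₃) = 1 ∨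
        ((S₀ : ℤ) - T₀) - ((S₁ : ℤ) - T₁) + ((S₂ : ℤ) - T₂) - ((S₃ : ℤ) - T₃) = -1) ∧
      2 * l₂ = 2 * l ∧
      star (⟨((P₀ + M₀ : ℕ) : ℤ) - (P₂ + M₂ : ℕ), ((P₁ + M₁ : ℕ) : ℤ) - (P₃ + M₃ : ℕ)⟩ : GaussianInt) *
            (⟨((S₀ + T₀ : ℕ) : ℤ) - (S₂ + T₂ : ℕ), ((S₁ + T₁ : ℕ) : ℤ) - (S₃ + T₃ : ℕ)⟩ : GaussianInt) * b +
          (⟨0, 1⟩ : GaussianInt) * (⟨((P₀ + M₀ : ℕ) : ℤ) - (P₂ + M₂ : ℕ), ((P₁ + M₁ : ℕ) : ℤ) - (P₃ + M₃ : ℕ)⟩ : GaussianInt) *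
            star (⟨((S₀ + T₀ : ℕ) : ℤ) - (S₂ + T₂ : ℕ), ((S₁ + T₁ : ℕ) : ℤ) - (S₃ + T₃ : ℕ)⟩ : GaussianInt) * b +
          (⟨0, 1⟩ : GaussianInt) * (⟨((P₀ + M₀ : ℕ) : ℤ) - (P₂ + M₂ : ℕ), ((P₁ + M₁ : ℕ) : ℤ) - (P₃ + M₃ : ℕ)⟩ : GaussianInt) *
            (⟨((S₀ + T₀ : ℕ) : ℤ) - (S₂ + T₂ : ℕ), ((S₁ + T₁ : ℕ) : ℤ) - (S₃ + T₃ : ℕ)⟩ : GaussianInt) * star b =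
        -(⟨0, 1⟩ : GaussianInt) ^ l.val ∧
      star (⟨((P₀ : ℤ) - M₀) - ((P₂ : ℤ) - M₂), ((P₁ : ℤ) - M₁) - ((P₃ : ℤ) - M₃)⟩ : GaussianInt) *
            (⟨((S₀ : ℤ) - T₀) - ((S₂ : ℤ) - T₂), ((S₁ : ℤ) - T₁) - ((S₃ : ℤ) - T₃)⟩ : GaussianInt) * b' +
          (-(⟨0, 1⟩ : GaussianInt)) * (⟨((P₀ : ℤ) - M₀) - ((P₂ : ℤ) - M₂), ((P₁ : ℤ) - M₁) - ((P₃ : ℤ) - M₃)⟩ : GaussianInt) *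
            star (⟨((S₀ : ℤ) - T₀) - ((S₂ : ℤ) - T₂), ((S₁ : ℤ) - T₁) - ((S₃ : ℤ) - T₃)⟩ : GaussianInt) * b' +
          (⟨0, 1⟩ : GaussianInt) * (⟨((P₀ : ℤ) - M₀) - ((P₂ : ℤ) - M₂), ((P₁ : ℤ) - M₁) - ((P₃ : ℤ) - M₃)⟩ : GaussianInt) *
            (⟨((S₀ : ℤ) - T₀) - ((S₂ : ℤ) - T₂), ((S₁ : ℤ) - T₁) - ((S₃ : ℤ) - T₃)⟩ : GaussianInt) * star b' =
        -(⟨0, 1⟩ : GaussianInt) ^ l₂.val := by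
  classical
  -- the pulled-back characters `ψ w a = i^⟨w, Φ a⟩`
  obtain ⟨ψ, hψ⟩ : ∃ ψ : ZMod 4 × ZMod 4 → A → GaussianInt,
      ∀ w a, ψ w a = (⟨0, 1⟩ : GaussianInt) ^ (w.1 * (Φ a).1 + w.2 * (Φ a).2).val := ⟨_, fun _ _ => rfl⟩
  have hψadd : ∀ w a b, ψ w (a + b) = ψ w a * ψ w b := fun w a b => by
    rw [hψ, hψ, hψ]; exact z4char_add Φ w a b
  have hψneg : ∀ w a, ψ w (-a) = star (ψ w a) := fun w a => by rw [hψ, hψ]; exact z4char_neg Φ w a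
  have hψsum : ∀ w, w ≠ 0 → ∑ a, ψ w a = 0 := fun w hw => by
    simp only [hψ]; exact z4char_sum_eq_zero Φ hΦ w hw
  have hψunit : ∀ w a, ψ w a * star (ψ w a) = 1 := fun w a => by rw [hψ]; exact ipow_mul_star _
  -- the identity `(E_w)` for every `w ≠ 0`
  have E : ∀ w : ZMod 4 × ZMod 4, w ≠ 0 →
      ψ w κ₁ * star (∑ x ∈ W, ψ w x) * (∑ x ∈ X, ψ w x) * (∑ y ∈ Y, ψ w y) +
        ψ w κ₂ * (∑ x ∈ W, ψ w x) * star (∑ x ∈ X, ψ w x) * (∑ y ∈ Y, ψ w y) +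
        ψ w κ₃ * (∑ x ∈ W, ψ w x) * (∑ x ∈ X, ψ w x) * star (∑ y ∈ Y, ψ w y) + ψ w x₀ = 0 := by
    intro w hw
    have h := cube_form_charsum (ψ w) (hψadd w) i₁ i₂ i₃ d₁₂ d₁₃ d₂₃ hcover
    rw [hψsum w hw] at h
    simp only [hψneg] at h
    simp only [star_sum]
    linear_combination -h
  -- shifts relative to `κ₁`
  obtain ⟨β, hβ⟩ : ∃ β, κ₂ = κ₁ + β := ⟨κ₂ - κ₁, by abel⟩
  obtain ⟨γ, hγ⟩ : ∃ γ, κ₃ = κ₁ + γ := ⟨κ₃ - κ₁, by abel⟩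
  -- real characters are self-conjugate
  have hreal2 : ∀ w : ZMod 4 × ZMod 4, ∀ a, star (ψ (w + w) a) = ψ (w + w) a := fun w a => by
    rw [hψ, z4pair_two, star_ipow_two_mul]
  have hrealS : ∀ (w : ZMod 4 × ZMod 4) (S : Finset A), star (∑ v ∈ S, ψ (w + w) v) = ∑ v ∈ S, ψ (w + w) v :=
    fun w S => by rw [star_sum]; exact sum_congr rfl fun v _ => hreal2 w v
  -- the real characters forbid `ψβ = ψγ = 1`
  have R2 : ∀ w : ZMod 4 × ZMod 4, w + w ≠ 0 → ¬ (ψ (w + w) β = 1 ∧ ψ (w + w) γ = 1) := by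
    rintro w hw ⟨h1, h2⟩
    have h := E (w + w) hw
    rw [hβ, hγ, hψadd, hψadd, h1, h2, hrealS, hrealS, hrealS] at h
    apply three_mul_ne_neg_ipow (ψ (w + w) κ₁ * (∑ x ∈ W, ψ (w + w) x) * (∑ x ∈ X, ψ (w + w) x) *
      (∑ y ∈ Y, ψ (w + w) y)) ((w + w).1 * (Φ x₀).1 + (w + w).2 * (Φ x₀).2)
    rw [← hψ]; linear_combination h
  have e20 : ∀ q : ZMod 4 × ZMod 4, ((1, 0) + (1, 0) : ZMod 4 × ZMod 4).1 * q.1 +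
      ((1, 0) + (1, 0) : ZMod 4 × ZMod 4).2 * q.2 = 2 * q.1 + 0 * q.2 := fun q => by
    simp only [Prod.mk_add_mk]; ring
  have e02 : ∀ q : ZMod 4 × ZMod 4, ((0, 1) + (0, 1) : ZMod 4 × ZMod 4).1 * q.1 +
      ((0, 1) + (0, 1) : ZMod 4 × ZMod 4).2 * q.2 = 0 * q.1 + 2 * q.2 := fun q => by
    simp only [Prod.mk_add_mk]; ring
  have e22 : ∀ q : ZMod 4 × ZMod 4, ((1, 1) + (1, 1) : ZMod 4 × ZMod 4).1 * q.1 +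
      ((1, 1) + (1, 1) : ZMod 4 × ZMod 4).2 * q.2 = 2 * q.1 + 2 * q.2 := fun q => by
    simp only [Prod.mk_add_mk]; ring
  have R2' : ∀ w : ZMod 4 × ZMod 4, w + w ≠ 0 →
      ¬ ((⟨0, 1⟩ : GaussianInt) ^ ((w + w).1 * (Φ β).1 + (w + w).2 * (Φ β).2).val = 1 ∧
         (⟨0, 1⟩ : GaussianInt) ^ ((w + w).1 * (Φ γ).1 + (w + w).2 * (Φ γ).2).val = 1) := by
    intro w hw; rw [← hψ, ← hψ]; exact R2 w hw
  obtain ⟨w, w', hwP, hwQ, hw'P, hw'Q⟩ := exists_dual_pair (Φ β) (Φ γ)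
    (by rw [← e20, ← e20]; exact R2' _ (by decide))
    (by rw [← e02, ← e02]; exact R2' _ (by decide))
    (by rw [← e22, ← e22]; exact R2' _ (by decide))
  -- the characters used are non-trivial
  have hw'0 : w' ≠ 0 := by
    rintro rfl
    simp only [Prod.fst_zero, Prod.snd_zero, zero_mul, add_zero] at hw'Q; exact absurd hw'Q (by decide)
  have h2w0 : w + w ≠ 0 := by
    intro h
    have := z4pair_two w (Φ β)
    rw [h, hwP, mul_one] at this
    simp only [Prod.fst_zero, Prod.snd_zero, zero_mul, add_zero] at this; exact absurd this (by decide)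
  have h2w'0 : w' + w' ≠ 0 := by
    intro h
    have := z4pair_two w' (Φ γ)
    rw [h, hw'Q, mul_one] at this
    simp only [Prod.fst_zero, Prod.snd_zero, zero_mul, add_zero] at this; exact absurd this (by decide)
  have h2ww'0 : (w + w') + (w + w') ≠ 0 := by
    intro h
    have := z4pair_two (w + w') (Φ β)
    rw [h, z4pair_add_left, hwP, hw'P, add_zero, mul_one] at this
    simp only [Prod.fst_zero, Prod.snd_zero, zero_mul, add_zero] at this; exact absurd this (by decide)
  have hww'0 : w + w' ≠ 0 := by
    intro h
    have := z4pair_add_left w w' (Φ β)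
    rw [h, hwP, hw'P, add_zero] at this
    simp only [Prod.fst_zero, Prod.snd_zero, zero_mul, add_zero] at this; exact absurd this (by decide)
  have hV₂0 : (w + w') + (w + w) ≠ 0 := by
    intro h
    have := z4pair_add_left (w + w') (w + w) (Φ γ)
    rw [h, z4pair_add_left, z4pair_two, hwQ, hw'Q, zero_add, mul_zero, add_zero] at this
    simp only [Prod.fst_zero, Prod.snd_zero, zero_mul, add_zero] at this; exact absurd this (by decide)
  -- coordinates of the points
  obtain ⟨m, hm⟩ : ∃ m : A → ZMod 4, ∀ x, m x = w.1 * (Φ x).1 + w.2 * (Φ x).2 := ⟨_, fun _ => rfl⟩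
  obtain ⟨n, hn⟩ : ∃ n : A → ZMod 4, ∀ x, n x = w'.1 * (Φ x).1 + w'.2 * (Φ x).2 := ⟨_, fun _ => rfl⟩
  obtain ⟨s, hs⟩ : ∃ s : A → ZMod 4, ∀ x, s x = (w + w').1 * (Φ x).1 + (w + w').2 * (Φ x).2 := ⟨_, fun _ => rfl⟩
  have hsmn : ∀ x, s x = m x + n x := fun x => by rw [hs, hm, hn, z4pair_add_left]
  have eψ1 : ∀ x, ψ (w + w') x = (⟨0, 1⟩ : GaussianInt) ^ (s x).val := fun x => by rw [hψ, hs]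
  have eψ2 : ∀ x, ψ ((w + w') + (w + w)) x = (⟨0, 1⟩ : GaussianInt) ^ (s x + 2 * m x).val := fun x => by
    rw [hψ, z4pair_add_left, z4pair_two, hm, hs]
  have eψ3 : ∀ x, ψ (w' + w') x = (⟨0, 1⟩ : GaussianInt) ^ (2 * (m x + s x)).val := fun x => by
    rw [hψ, z4pair_two, hsmn, ← zmod4_two_mul_eq, hn]
  have eψ4 : ∀ x, ψ (w + w) x = (⟨0, 1⟩ : GaussianInt) ^ (2 * m x).val := fun x => by rw [hψ, z4pair_two, hm]
  have eψ5 : ∀ x, ψ ((w + w') + (w + w')) x = (⟨0, 1⟩ : GaussianInt) ^ (2 * s x).val := fun x => by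
    rw [hψ, z4pair_two, hs]
  have hs1 : ∀ S : Finset A, ∑ x ∈ S, ψ (w + w') x = ∑ x ∈ S, (⟨0, 1⟩ : GaussianInt) ^ (s x).val :=
    fun S => sum_congr rfl fun x _ => eψ1 x
  have hs2 : ∀ S : Finset A, ∑ x ∈ S, ψ ((w + w') + (w + w)) x =
      ∑ x ∈ S, (⟨0, 1⟩ : GaussianInt) ^ (s x + 2 * m x).val := fun S => sum_congr rfl fun x _ => eψ2 x
  have hs3 : ∀ S : Finset A, ∑ x ∈ S, ψ (w' + w') x = ∑ x ∈ S, (⟨0, 1⟩ : GaussianInt) ^ (2 * (m x + s x)).val :=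
    fun S => sum_congr rfl fun x _ => eψ3 x
  have hs4 : ∀ S : Finset A, ∑ x ∈ S, ψ (w + w) x = ∑ x ∈ S, (⟨0, 1⟩ : GaussianInt) ^ (2 * m x).val :=
    fun S => sum_congr rfl fun x _ => eψ4 x
  have hs5 : ∀ S : Finset A, ∑ x ∈ S, ψ ((w + w') + (w + w')) x =
      ∑ x ∈ S, (⟨0, 1⟩ : GaussianInt) ^ (2 * s x).val := fun S => sum_congr rfl fun x _ => eψ5 x
  -- values of the shifts at the five characters
  have vβ3 : ψ (w' + w') β = 1 := by rw [hψ, z4pair_two, hw'P, mul_zero, ZMod.val_zero, pow_zero]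
  have vγ3 : ψ (w' + w') γ = -1 := by rw [hψ, z4pair_two, hw'Q, mul_one, ipow_zmod_two]
  have vβ4 : ψ (w + w) β = -1 := by rw [hψ, z4pair_two, hwP, mul_one, ipow_zmod_two]
  have vγ4 : ψ (w + w) γ = 1 := by rw [hψ, z4pair_two, hwQ, mul_zero, ZMod.val_zero, pow_zero]
  have vβ5 : ψ ((w + w') + (w + w')) β = -1 := by
    rw [hψ, z4pair_two, z4pair_add_left, hwP, hw'P, add_zero, mul_one, ipow_zmod_two]
  have vγ5 : ψ ((w + w') + (w + w')) γ = -1 := by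
    rw [hψ, z4pair_two, z4pair_add_left, hwQ, hw'Q, zero_add, mul_one, ipow_zmod_two]
  have vβ1 : ψ (w + w') β = ⟨0, 1⟩ := by rw [hψ, z4pair_add_left, hwP, hw'P, add_zero, ipow_zmod_one]
  have vγ1 : ψ (w + w') γ = ⟨0, 1⟩ := by rw [hψ, z4pair_add_left, hwQ, hw'Q, zero_add, ipow_zmod_one]
  have vβ2 : ψ ((w + w') + (w + w)) β = -⟨0, 1⟩ := by
    rw [hψ, z4pair_add_left, z4pair_add_left, z4pair_two, hwP, hw'P, add_zero, mul_one,
      show (1 + 2 : ZMod 4) = 3 by norm_num, ipow_zmod_three]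
  have vγ2 : ψ ((w + w') + (w + w)) γ = ⟨0, 1⟩ := by
    rw [hψ, z4pair_add_left, z4pair_add_left, z4pair_two, hwQ, hw'Q, zero_add, mul_zero, add_zero, ipow_zmod_one]
  -- (R) the six real-character facts
  have RW1 := int_eq_of_mul_eq_neg_ipow _ (ψ (w' + w') κ₁ * (∑ x ∈ X, ψ (w' + w') x) * (∑ y ∈ Y, ψ (w' + w') y))
    ((w' + w').1 * (Φ x₀).1 + (w' + w').2 * (Φ x₀).2) (by
      have h := E (w' + w') h2w'0
      rw [hβ, hγ, hψadd, hψadd, vβ3, vγ3, hrealS, hrealS, hrealS, hs3 W, sum_2mn W m s, hψ (w' + w') x₀] at h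
      rw [← sub_eq_zero, ← h]; ring)
  have RX1 := int_eq_of_mul_eq_neg_ipow _ (ψ (w' + w') κ₁ * (∑ x ∈ W, ψ (w' + w') x) * (∑ y ∈ Y, ψ (w' + w') y))
    ((w' + w').1 * (Φ x₀).1 + (w' + w').2 * (Φ x₀).2) (by
      have h := E (w' + w') h2w'0
      rw [hβ, hγ, hψadd, hψadd, vβ3, vγ3, hrealS, hrealS, hrealS, hs3 X, sum_2mn X m s, hψ (w' + w') x₀] at h
      rw [← sub_eq_zero, ← h]; ring)
  have RW2 := int_eq_of_mul_eq_neg_ipow _ (ψ (w + w) κ₁ * (∑ x ∈ X, ψ (w + w) x) * (∑ y ∈ Y, ψ (w + w) y))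
    ((w + w).1 * (Φ x₀).1 + (w + w).2 * (Φ x₀).2) (by
      have h := E (w + w) h2w0
      rw [hβ, hγ, hψadd, hψadd, vβ4, vγ4, hrealS, hrealS, hrealS, hs4 W, sum_2m W m s, hψ (w + w) x₀] at h
      rw [← sub_eq_zero, ← h]; ring)
  have RX2 := int_eq_of_mul_eq_neg_ipow _ (ψ (w + w) κ₁ * (∑ x ∈ W, ψ (w + w) x) * (∑ y ∈ Y, ψ (w + w) y))
    ((w + w).1 * (Φ x₀).1 + (w + w).2 * (Φ x₀).2) (by
      have h := E (w + w) h2w0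
      rw [hβ, hγ, hψadd, hψadd, vβ4, vγ4, hrealS, hrealS, hrealS, hs4 X, sum_2m X m s, hψ (w + w) x₀] at h
      rw [← sub_eq_zero, ← h]; ring)
  have RW3 := int_eq_of_mul_eq_neg_ipow _ (-(ψ ((w + w') + (w + w')) κ₁ * (∑ x ∈ X, ψ ((w + w') + (w + w')) x) *
      (∑ y ∈ Y, ψ ((w + w') + (w + w')) y))) (((w + w') + (w + w')).1 * (Φ x₀).1 + ((w + w') + (w + w')).2 * (Φ x₀).2) (by
      have h := E ((w + w') + (w + w')) h2ww'0
      rw [hβ, hγ, hψadd, hψadd, vβ5, vγ5, hrealS, hrealS, hrealS, hs5 W, sum_2n W m s,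
        hψ ((w + w') + (w + w')) x₀] at h
      rw [← sub_eq_zero, ← h]; ring)
  have RX3 := int_eq_of_mul_eq_neg_ipow _ (-(ψ ((w + w') + (w + w')) κ₁ * (∑ x ∈ W, ψ ((w + w') + (w + w')) x) *
      (∑ y ∈ Y, ψ ((w + w') + (w + w')) y))) (((w + w') + (w + w')).1 * (Φ x₀).1 + ((w + w') + (w + w')).2 * (Φ x₀).2) (by
      have h := E ((w + w') + (w + w')) h2ww'0
      rw [hβ, hγ, hψadd, hψadd, vβ5, vγ5, hrealS, hrealS, hrealS, hs5 X, sum_2n X m s,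
        hψ ((w + w') + (w + w')) x₀] at h
      rw [← sub_eq_zero, ← h]; ring)
  -- the two complex identities
  have hx₀ : ∀ v : ZMod 4 × ZMod 4, ψ v x₀ * star (ψ v κ₁) =
      (⟨0, 1⟩ : GaussianInt) ^ (v.1 * (Φ (x₀ - κ₁)).1 + v.2 * (Φ (x₀ - κ₁)).2).val := fun v => by
    rw [← hψ, sub_eq_add_neg, hψadd, hψneg]
  have E1 : star (∑ x ∈ W, (⟨0, 1⟩ : GaussianInt) ^ (s x).val) * (∑ x ∈ X, (⟨0, 1⟩ : GaussianInt) ^ (s x).val) *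
        (∑ y ∈ Y, ψ (w + w') y) +
      (⟨0, 1⟩ : GaussianInt) * (∑ x ∈ W, (⟨0, 1⟩ : GaussianInt) ^ (s x).val) *
        star (∑ x ∈ X, (⟨0, 1⟩ : GaussianInt) ^ (s x).val) * (∑ y ∈ Y, ψ (w + w') y) +
      (⟨0, 1⟩ : GaussianInt) * (∑ x ∈ W, (⟨0, 1⟩ : GaussianInt) ^ (s x).val) *
        (∑ x ∈ X, (⟨0, 1⟩ : GaussianInt) ^ (s x).val) * star (∑ y ∈ Y, ψ (w + w') y) =
      -(⟨0, 1⟩ : GaussianInt) ^ ((w + w').1 * (Φ (x₀ - κ₁)).1 + (w + w').2 * (Φ (x₀ - κ₁)).2).val := by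
    have h := E (w + w') hww'0
    rw [hβ, hγ, hψadd, hψadd, vβ1, vγ1, hs1 W, hs1 X] at h
    rw [← hx₀ (w + w')]
    linear_combination (star (ψ (w + w') κ₁)) * h -
      (star (∑ x ∈ W, (⟨0, 1⟩ : GaussianInt) ^ (s x).val) * (∑ x ∈ X, (⟨0, 1⟩ : GaussianInt) ^ (s x).val) *
          (∑ y ∈ Y, ψ (w + w') y) +
        (⟨0, 1⟩ : GaussianInt) * (∑ x ∈ W, (⟨0, 1⟩ : GaussianInt) ^ (s x).val) *
          star (∑ x ∈ X, (⟨0, 1⟩ : GaussianInt) ^ (s x).val) * (∑ y ∈ Y, ψ (w + w') y) +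
        (⟨0, 1⟩ : GaussianInt) * (∑ x ∈ W, (⟨0, 1⟩ : GaussianInt) ^ (s x).val) *
          (∑ x ∈ X, (⟨0, 1⟩ : GaussianInt) ^ (s x).val) * star (∑ y ∈ Y, ψ (w + w') y)) * (hψunit (w + w') κ₁)
  have E2 : star (∑ x ∈ W, (⟨0, 1⟩ : GaussianInt) ^ (s x + 2 * m x).val) *
        (∑ x ∈ X, (⟨0, 1⟩ : GaussianInt) ^ (s x + 2 * m x).val) * (∑ y ∈ Y, ψ ((w + w') + (w + w)) y) +
      (-(⟨0, 1⟩ : GaussianInt)) * (∑ x ∈ W, (⟨0, 1⟩ : GaussianInt) ^ (s x + 2 * m x).val) *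
        star (∑ x ∈ X, (⟨0, 1⟩ : GaussianInt) ^ (s x + 2 * m x).val) * (∑ y ∈ Y, ψ ((w + w') + (w + w)) y) +
      (⟨0, 1⟩ : GaussianInt) * (∑ x ∈ W, (⟨0, 1⟩ : GaussianInt) ^ (s x + 2 * m x).val) *
        (∑ x ∈ X, (⟨0, 1⟩ : GaussianInt) ^ (s x + 2 * m x).val) * star (∑ y ∈ Y, ψ ((w + w') + (w + w)) y) =
      -(⟨0, 1⟩ : GaussianInt) ^ (((w + w') + (w + w)).1 * (Φ (x₀ - κ₁)).1 +
        ((w + w') + (w + w)).2 * (Φ (x₀ - κ₁)).2).val := by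
    have h := E ((w + w') + (w + w)) hV₂0
    rw [hβ, hγ, hψadd, hψadd, vβ2, vγ2, hs2 W, hs2 X] at h
    rw [← hx₀ ((w + w') + (w + w))]
    linear_combination (star (ψ ((w + w') + (w + w)) κ₁)) * h -
      (star (∑ x ∈ W, (⟨0, 1⟩ : GaussianInt) ^ (s x + 2 * m x).val) *
          (∑ x ∈ X, (⟨0, 1⟩ : GaussianInt) ^ (s x + 2 * m x).val) * (∑ y ∈ Y, ψ ((w + w') + (w + w)) y) +
        (-(⟨0, 1⟩ : GaussianInt)) * (∑ x ∈ W, (⟨0, 1⟩ : GaussianInt) ^ (s x + 2 * m x).val) *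
          star (∑ x ∈ X, (⟨0, 1⟩ : GaussianInt) ^ (s x + 2 * m x).val) * (∑ y ∈ Y, ψ ((w + w') + (w + w)) y) +
        (⟨0, 1⟩ : GaussianInt) * (∑ x ∈ W, (⟨0, 1⟩ : GaussianInt) ^ (s x + 2 * m x).val) *
          (∑ x ∈ X, (⟨0, 1⟩ : GaussianInt) ^ (s x + 2 * m x).val) * star (∑ y ∈ Y, ψ ((w + w') + (w + w)) y)) *
        (hψunit ((w + w') + (w + w)) κ₁)
  -- the character sums of `W`, `X` through the profiles
  have hcW : ∑ x ∈ W, (⟨0, 1⟩ : GaussianInt) ^ (s x).val =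
      ⟨(((W.filter fun x => s x = 0 ∧ 2 * m x = 0).card + (W.filter fun x => s x = 0 ∧ 2 * m x = 2).card : ℕ) : ℤ) -
        ((W.filter fun x => s x = 2 ∧ 2 * m x = 0).card + (W.filter fun x => s x = 2 ∧ 2 * m x = 2).card : ℕ),
       (((W.filter fun x => s x = 1 ∧ 2 * m x = 0).card + (W.filter fun x => s x = 1 ∧ 2 * m x = 2).card : ℕ) : ℤ) -
        ((W.filter fun x => s x = 3 ∧ 2 * m x = 0).card + (W.filter fun x => s x = 3 ∧ 2 * m x = 2).card : ℕ)⟩ := by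
    apply Zsqrtd.ext
    · rw [sum_re_n W m s]; push_cast; ring
    · rw [sum_im_n W m s]; push_cast; ring
  have hcX : ∑ x ∈ X, (⟨0, 1⟩ : GaussianInt) ^ (s x).val =
      ⟨(((X.filter fun x => s x = 0 ∧ 2 * m x = 0).card + (X.filter fun x => s x = 0 ∧ 2 * m x = 2).card : ℕ) : ℤ) -
        ((X.filter fun x => s x = 2 ∧ 2 * m x = 0).card + (X.filter fun x => s x = 2 ∧ 2 * m x = 2).card : ℕ),
       (((X.filter fun x => s x = 1 ∧ 2 * m x = 0).card + (X.filter fun x => s x = 1 ∧ 2 * m x = 2).card : ℕ) : ℤ) -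
        ((X.filter fun x => s x = 3 ∧ 2 * m x = 0).card + (X.filter fun x => s x = 3 ∧ 2 * m x = 2).card : ℕ)⟩ := by
    apply Zsqrtd.ext
    · rw [sum_re_n X m s]; push_cast; ring
    · rw [sum_im_n X m s]; push_cast; ring
  have hcW' : ∑ x ∈ W, (⟨0, 1⟩ : GaussianInt) ^ (s x + 2 * m x).val =
      ⟨(((W.filter fun x => s x = 0 ∧ 2 * m x = 0).card : ℤ) - (W.filter fun x => s x = 0 ∧ 2 * m x = 2).card) -
        (((W.filter fun x => s x = 2 ∧ 2 * m x = 0).card : ℤ) - (W.filter fun x => s x = 2 ∧ 2 * m x = 2).card),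
       (((W.filter fun x => s x = 1 ∧ 2 * m x = 0).card : ℤ) - (W.filter fun x => s x = 1 ∧ 2 * m x = 2).card) -
        (((W.filter fun x => s x = 3 ∧ 2 * m x = 0).card : ℤ) - (W.filter fun x => s x = 3 ∧ 2 * m x = 2).card)⟩ := by
    apply Zsqrtd.ext
    · rw [sum_re_n2m W m s]; push_cast; ring
    · rw [sum_im_n2m W m s]; push_cast; ring
  have hcX' : ∑ x ∈ X, (⟨0, 1⟩ : GaussianInt) ^ (s x + 2 * m x).val =
      ⟨(((X.filter fun x => s x = 0 ∧ 2 * m x = 0).card : ℤ) - (X.filter fun x => s x = 0 ∧ 2 * m x = 2).card) -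
        (((X.filter fun x => s x = 2 ∧ 2 * m x = 0).card : ℤ) - (X.filter fun x => s x = 2 ∧ 2 * m x = 2).card),
       (((X.filter fun x => s x = 1 ∧ 2 * m x = 0).card : ℤ) - (X.filter fun x => s x = 1 ∧ 2 * m x = 2).card) -
        (((X.filter fun x => s x = 3 ∧ 2 * m x = 0).card : ℤ) - (X.filter fun x => s x = 3 ∧ 2 * m x = 2).card)⟩ := by
    apply Zsqrtd.ext
    · rw [sum_re_n2m X m s]; push_cast; ring
    · rw [sum_im_n2m X m s]; push_cast; ring
  rw [hcW, hcX] at E1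
  rw [hcW', hcX'] at E2
  have hl₂ : (2 : ZMod 4) * (((w + w') + (w + w)).1 * (Φ (x₀ - κ₁)).1 + ((w + w') + (w + w)).2 * (Φ (x₀ - κ₁)).2) =
      2 * ((w + w').1 * (Φ (x₀ - κ₁)).1 + (w + w').2 * (Φ (x₀ - κ₁)).2) := by
    rw [z4pair_add_left, z4pair_two]
    have h4 : (4 : ZMod 4) = 0 := by decide
    linear_combination (w.1 * (Φ (x₀ - κ₁)).1 + w.2 * (Φ (x₀ - κ₁)).2) * h4
  have tW := sum_total W m s
  have tX := sum_total X m s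
  refine ⟨(W.filter fun x => s x = 0 ∧ 2 * m x = 0).card, (W.filter fun x => s x = 0 ∧ 2 * m x = 2).card,
    (W.filter fun x => s x = 1 ∧ 2 * m x = 0).card, (W.filter fun x => s x = 1 ∧ 2 * m x = 2).card,
    (W.filter fun x => s x = 2 ∧ 2 * m x = 0).card, (W.filter fun x => s x = 2 ∧ 2 * m x = 2).card,
    (W.filter fun x => s x = 3 ∧ 2 * m x = 0).card, (W.filter fun x => s x = 3 ∧ 2 * m x = 2).card,
    (X.filter fun x => s x = 0 ∧ 2 * m x = 0).card, (X.filter fun x => s x = 0 ∧ 2 * m x = 2).card,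
    (X.filter fun x => s x = 1 ∧ 2 * m x = 0).card, (X.filter fun x => s x = 1 ∧ 2 * m x = 2).card,
    (X.filter fun x => s x = 2 ∧ 2 * m x = 0).card, (X.filter fun x => s x = 2 ∧ 2 * m x = 2).card,
    (X.filter fun x => s x = 3 ∧ 2 * m x = 0).card, (X.filter fun x => s x = 3 ∧ 2 * m x = 2).card,
    (w + w').1 * (Φ (x₀ - κ₁)).1 + (w + w').2 * (Φ (x₀ - κ₁)).2,
    ((w + w') + (w + w)).1 * (Φ (x₀ - κ₁)).1 + ((w + w') + (w + w)).2 * (Φ (x₀ - κ₁)).2,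
    ∑ y ∈ Y, ψ (w + w') y, ∑ y ∈ Y, ψ ((w + w') + (w + w)) y, ?_, ?_, ?_, ?_, ?_, ?_, ?_, ?_, hl₂, E1, E2⟩
  · omega
  · omega
  · rcases RW3 with h | h <;> [left; right] <;> push_cast <;> omega
  · rcases RW2 with h | h <;> [left; right] <;> omega
  · rcases RW1 with h | h <;> [left; right] <;> omega
  · rcases RX3 with h | h <;> [left; right] <;> push_cast <;> omega
  · rcases RX2 with h | h <;> [left; right] <;> omega
  · rcases RX1 with h | h <;> [left; right] <;> omega

end Main

end Summit.MatrixMultiplication.OmegaCensus
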